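import Summits.QuantumFields.YangMills.Theorems.BalabanUVNodesN05SubBP2DKnitGammaPrimeZdLan
import Literature.MathematicalPhysics.QuantumFieldTheory.Balaban1983to89.B8LeafOfRecordSubBPCutPFields8
import Literature.MathematicalPhysics.QuantumFieldTheory.Balaban1983to89.Node00.CarriersB8SubBP2D

/-!
# BalabanUVNodes ∕ N05 ([Balaban1985RegularSpaces] Lemma 1 p. 79 – Thm 8 p. 101): THE «P₂C» KNITS READ INTO NODE 00's RE-PINNED SLOT
# `Node00.CarriersB8SubBP2C.B8LeafOfRecordSubBP₂D` (dag-n05-w1, p604316) — (i) at the cut layer `λ.cutSubB J lan c₁` from the knit D9b₂C (p605228; Prop 7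
# served, `p5e p5u p6` displayed) and (ii) ★★★ at the print-class cut layer `λ.cutSubBP J (zdLan θ.L λ.B₁ ∘ ι) c₁⋆ ρ₀` from D9c₂C (p605257) at `c₁ := 0` + `B8LeafRSC.withP6` (EVERY printed member of
# [B8] served: Lemma 1, Thm 2, Prop 3, Thm 4, Prop 5 ∃∕!, Prop 6, Prop 7, Thm 8-surviving) — two `Iff.rfl`-deep corollaries (the pin's
# `b8LeafOfRecordSubBP₂D_cutSubB_iff`, dag-n05-e's `b8LeafOfRecordSubBP₂D_cutSubBP_iff`, p605418); the N05 SLOT OF RECORD (after the «P₂C» re-pin) is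
# thereby inhabited at a NAMED layer modulo [Balaban1985BackgroundPropagators]-type sockets ∕ letters (N06 content) and constants only

EDITION «P₂D» (dag-n05-d g12; dag-n05-w1 LOCATED-SLET p613168 ∕ `Node00/CarriersB8SubD` ∕ the «P₂D» pin `Node00/CarriersB8SubBP2D`): the «P₂C» slot file
RE-KEYED onto the (1.5)-obeying admissible sub-index `IdxB8SubD θ` — the knits are the «P₂D» twins (every class-wide [4]-type binder carries print's (1.5) layer law
«`∀ l, l < i.k → ∀ z ∈ i.Λs i.k l, ((θ.L : ℤ) ^ l) • z ∈ B8ConstraintBonds.Lam θ.L i.Ω l`» after `DomainSeq`), the slot is `B8LeafOfRecordSubBP₂D` (same leaf shape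
`B8LeafRSC`, families precomposed with `IdxB8SubD.val`).  The rest of this header is the «P₂C» header VERBATIM.

Track A of `YM-PLAN.md` (cell `pub-ymgap`, HUMAN RULING D-0062), node **N05**; seat `pub-ymgap-dag-n05-d` (g11), 2026-08-28; bears on K1⁷ `stmt-QuantumFields-20542`
(`--supports … --as helper`, count-neutral).  THE STORY is in the «P₂C» knit files (`BalabanUVNodesN05SubBP2DKnitGammaPrime{,ZdLan,PrintCube,PrintCubeZdLan}`),
which are PIN-FREE (they conclude the leaf shape `B8LeafKnitRSC.B8LeafRSC` over the collar sub-family of the edition-δ₂ carrier); THIS FILE reads them into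
dag-n05-w1's pin by the pin's `Iff.rfl` reading lemmas: `IdxB8SubC θ`, `c₇OfRecord θ = 530·θ.D·θ.L²`, `famB8OfRecordSubBP₂D θ β len j = zdGF3HP₂ θ.𝔸 θ.L β len j.1.1.1.1`
unfold by `rfl`.  Nothing else.

WHAT IS PROVED (two one-term corollaries; no estimate; no new definition):
* ★★ **`b8LeafOfRecordSubBP₂D_cutSubB_of_knit_lettersSrc_γ'`** — D9b₂C's hypotheses VERBATIM ⊢ `B8LeafOfRecordSubBP₂D θ (λ.cutSubB J lan c₁)` (the successor of
  D9b p596490 on the re-pinned slot: `p5e p5u p6` displayed, Prop 7 served).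
* ★★★ **`b8LeafOfRecordSubBP₂D_cutSubBP_zdLan_printCube_of_knit_lettersSrc_γ'`** — D9d₂C′'s hypotheses VERBATIM ⊢
  `B8LeafOfRecordSubBP₂D θ (λ.cutSubBP J (zdLan θ.L λ.B₁ ∘ ι) c₁⋆ ρ₀)` — the slot of record inhabited at the named layer with NO printed member of [B8] among the
  hypotheses: only [4]-type sockets ∕ letters at the collar law members and at the `zdLan` members (N06 content), Theorem 8's constants with the layer equations and
  guards, p596570's θ-level Prop-6 witness clause `hP6` (a theorem's conjunct, `θ.D ≥ 2`, `θ.L ≥ 5`) and ONE dial `B₁⋆ ≤ λ.B₁`.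
HONEST FRAMING: `Iff.rfl`-deep bookkeeping; 0 estimates; sockets ∕ letters are HYPOTHESES (N06; `m ≥ 1` OPEN; NOT claimed); Prop 7 in the repaired currency
`c₇OfRecord θ = 530·D·L²` (weaker than print's `2α₂` — WATCH-P7-CURRENCY-RECORD; dag-n05-w2's necessity certificate G-B8-01 transport); the record's ∃-over-λ currency
and the node's booking are the planners' ∕ chair's; count-neutral; **N05 NOT discharged**; Bałaban AS PRINTED with locators; one finite 𝕋⁴ programme at fixed ε;
nothing continuum ∕ ℝ⁴ ∕ OS ∕ mass-gap ∕ Clay.  No `sorry`, no new definition.  Unit `pub-ymgap-dag-n05-d` (g11), 2026-08-28.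
[cite: Balaban1985RegularSpaces, Lemma 1 p.79, Thm 2 p.83, Prop. 3 p.87, Thm 4 p.88, Prop. 5 (1.106)–(1.110) p.94, Prop. 6 (1.135)–(1.138) p.99, Prop. 7 (1.144)–(1.145) p.100, Thm 8 (1.146) p.101, (1.3)–(1.4) p.77; Balaban1985BackgroundPropagators, Thm 3.1 p.397, Thm 3.3 p.398, (3.40) p.397]
-/

noncomputable section

namespace Summit.QuantumFields.YangMills.BalabanUVNodes.N05SubBP2DSlotGammaPrime

open Literature.MathematicalPhysics.QuantumFieldTheory.Balaban1983to89
open Literature.MathematicalPhysics.QuantumFieldTheory.Balaban1983to89.Node00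
open Literature.MathematicalPhysics.QuantumFieldTheory.Balaban1983to89.B8IdxB8LawsB (IdxB8LawsB IdxB8SubB)
open Literature.MathematicalPhysics.QuantumFieldTheory.Balaban1983to89.B8LeafModelZd (ZdIdx)
open Literature.MathematicalPhysics.QuantumFieldTheory.Balaban1983to89.B8LeafModelZd3 (SockB9P3)
open Literature.MathematicalPhysics.QuantumFieldTheory.Balaban1983to89.B9SupplySockB9P3ZdGammaUnivDelta2 (SockB9P3H2)
open Literature.MathematicalPhysics.QuantumFieldTheory.Balaban1983to89.B8LeafModelZd3P (zdGF3P zdGF3HP)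
open Literature.MathematicalPhysics.QuantumFieldTheory.Balaban1983to89.B8LeafModelZd3P2 (zdGF3P₂ zdGF3HP₂)
open Literature.MathematicalPhysics.QuantumFieldTheory.Balaban1983to89.B8LeafKnitRSC (B8LeafRSC)
open Literature.MathematicalPhysics.QuantumFieldTheory.Balaban1983to89.B8Prop7TowerAxialRecord (toAxialTowerResid)
open Literature.MathematicalPhysics.QuantumFieldTheory.Balaban1983to89.B8TowerBondsPrinted (towerBondsP)
open Literature.MathematicalPhysics.QuantumFieldTheory.Balaban1983to89.B8SockLettersRD (SockLettersRD)
open Literature.MathematicalPhysics.QuantumFieldTheory.Balaban1983to89.B8Lemma1NonAbelian (mulCfg blockPairNA)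
open Literature.MathematicalPhysics.QuantumFieldTheory.Balaban1983to89.B8SockSP5UniformThresholdsSrcGammaPrime (exists_uniform_threshold_sp5_src_γ' exists_uniform_threshold_sp5base_src_γ' exists_uniform_threshold_sp5u_src_γ')
open Literature.MathematicalPhysics.QuantumFieldTheory.Balaban1983to89.B8LanF146 (LanF146 lanF146_zero_iff)
open Literature.MathematicalPhysics.QuantumFieldTheory.Balaban1983to89.B8Eq138LandauZd (covLap QT InR138 IsLandau146W inR138_zero)
open Summit.QuantumFields.YangMills.BalabanUVNodes.N05SubBP2DKnitGammaPrime (b8LeafRSC_P2D_of_knit_lettersSrc_γ')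
open Literature.MathematicalPhysics.QuantumFieldTheory.Balaban1983to89.B8Prop5LandauDataZd (ZdLanIdx zdLan)
open Literature.MathematicalPhysics.QuantumFieldTheory.Balaban1983to89.B8Prop5ExistsZdLan (prop5Exists_zdLan_of_lettersRD)
open Literature.MathematicalPhysics.QuantumFieldTheory.Balaban1983to89.B8Prop5UniqueZdLan (prop5Unique_zdLan_of_lettersUB)
open MatrixLog B7Prop1Explicit B7Prop2Explicit B7Prop1Local B7Eq92Concrete
open B8Ineq130 (tlo thi)
open B8Ineq132 (InAk covDerivFwd)
open B7Eq78Linearization (zdBlocking QprimeIter)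
open B8Eq119TwistedAxial (bgT Restr129 InAx)
open B8Eq140Level (SideTouches)
open B8Eq1117Concrete (XSpace)
open B8Prop5ContractionKLevel (Bd2)
open B8LambdaSpaceKLevel (wt)
open B8Eq184Proof (gaugeExp cfgExp)
open B8Eq146AExpansion (iEta plaqCovDeriv)
open B8Eq143PlaqExpansion (pdiv)
open B7Prop4GeneralLevels (linCovIter)
open B8Eq155JBound (Jcur wsup)
open B8ScaledSupNorm (bondNorm msup Bdd msup_le bdd_of_forall)
open B9Eq340HolderZd (hquot AdmPair)

-- `Site` alone could resolve to the torus sites of `Setup.lean`; re-export the `ℤ^d` sites of `B7Prop1Explicit`.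
export B7Prop1Explicit (Site)

open Summit.QuantumFields.YangMills.BalabanUVNodes.N05SubBP2DKnitGammaPrimeZdLan (b8LeafRSC_P2D_zdLan_of_knit_lettersSrc_γ')
open Literature.MathematicalPhysics.QuantumFieldTheory.Balaban1983to89.B8LeafOfRecordSubBPCutPFields8 (prop6Printed_cubB8OfRecord_subB_of_nonpos)


section Slot

/-- ★★ **THE RE-PINNED SLOT AT THE CUT LAYER, FROM THE «P₂C» KNIT** (`Iff.rfl`-deep: the pin's `b8LeafOfRecordSubBP₂D_cutSubB_iff`): D9b₂C's hypotheses
VERBATIM ⊢ `B8LeafOfRecordSubBP₂D θ (λ.cutSubB J lan c₁)`; Prop 7 served inside the knit, `p5e p5u p6` displayed, [4]-type sockets ∕ letters at the collar law members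
HYPOTHESES. [cite: Balaban1985RegularSpaces, Lemma 1 – Thm 8 pp.79–101, Prop. 7 (1.145) p.100; Balaban1985BackgroundPropagators, Thm 3.1 p.397, Thm 3.3 p.398] -/
theorem b8LeafOfRecordSubBP₂D_cutSubB_of_knit_lettersSrc_γ' {θ : Stage3Params} (lam : ResidB8 θ) (hD : 2 ≤ θ.D)
    {cB9 B₀'H B₂' BG BR cL : ℝ}
    (hC₂eq : lam.C₂ = 2097152 * ((θ.D : ℝ) + 1) ^ 2 * (θ.L : ℝ) ^ 2)
    (hcB9 : 0 < cB9) (hB₀'H : 0 < B₀'H) (hB₂' : 0 ≤ B₂') (hBG : 0 ≤ BG) (hBR : 0 ≤ BR) (hcL : 0 < cL)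
    -- [4]'s letters AT THE `Ω₀ = ℤᵈ` LAW MEMBERS ONLY: existence side (laws on print's domains) and uniqueness side
    (SLet : ∀ i : ZdIdx θ.D θ.L, i.Ω 0 = Set.univ → IdxB8LawsB θ.L i → B8ConstraintBonds.DomainSeq θ.L i.Ω → (∀ l, l < i.k → ∀ z ∈ i.Λs i.k l, ((θ.L : ℤ) ^ l) • z ∈ B8ConstraintBonds.Lam θ.L i.Ω l) → SockLettersRD (𝔸 := θ.𝔸) θ.L BG BR B₀'H B₂' cL i.η i.k i.Ω i.Λs)
    (SLetUB : ∀ i : ZdIdx θ.D θ.L, i.Ω 0 = Set.univ → IdxB8LawsB θ.L i → B8ConstraintBonds.DomainSeq θ.L i.Ω → (∀ l, l < i.k → ∀ z ∈ i.Λs i.k l, ((θ.L : ℤ) ^ l) • z ∈ B8ConstraintBonds.Lam θ.L i.Ω l) → ∀ α₀ : ℝ, 0 < α₀ → α₀ ≤ cL → ∀ U₀ : Site θ.D → Fin θ.D → θ.𝔸ˣ, (∀ x κ, U₀ x κ ∈ unitaryUnits θ.𝔸) →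
      InAk θ.L i.k i.η α₀ i.Ω U₀ →
      ∃ (g Δ : (Site θ.D → θ.𝔸) →ₗ[ℂ] (Site θ.D → θ.𝔸)) (q : (Site θ.D → θ.𝔸) →ₗ[ℂ] (ℕ → Site θ.D → θ.𝔸))
        (qs : (ℕ → Site θ.D → θ.𝔸) →ₗ[ℂ] (Site θ.D → θ.𝔸)) (Aw c : (ℕ → Site θ.D → θ.𝔸) →ₗ[ℂ] (ℕ → Site θ.D → θ.𝔸))
        (H' : XSpace θ.D i.k θ.𝔸 →ₗ[ℂ] (Site θ.D → θ.𝔸)),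
        (∀ x : Site θ.D → θ.𝔸, (∃ C : ℝ, ∀ y, ‖x y‖ ≤ C) → g (Δ x + qs (Aw (q x))) = x) ∧ (∀ φ, qs (c (q (g (g (qs φ))))) = qs φ) ∧
        (∀ (f : Site θ.D → θ.𝔸), ∀ x ∈ i.Ω 0, Δ f x = covLap i.η U₀ ((i.Ω 0).indicator f) x) ∧
        (∀ (μ : ℕ → Site θ.D → θ.𝔸), ∀ x ∈ i.Ω 0, qs μ x = QT θ.L i.k (i.Λs i.k) U₀ μ x) ∧
        (∀ (f : Site θ.D → θ.𝔸) (n : ℕ), n ≤ i.k → ∀ y ∈ i.Λs i.k n, q f n y = QprimeIter (zdBlocking θ.D θ.L) (bgT θ.L U₀) n f y) ∧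
        (∀ (f : Site θ.D → θ.𝔸) (n : ℕ) (y : Site θ.D), ¬ (n ≤ i.k ∧ y ∈ i.Λs i.k n) → q f n y = 0) ∧
        (∀ (X : XSpace θ.D i.k θ.𝔸) (x : Site θ.D), ‖H' X x‖ ≤ B₀'H * ‖X‖) ∧
        (∀ n, n ≤ i.k → ∀ (X : XSpace θ.D i.k θ.𝔸), ∀ p ∈ {b : Site θ.D × Fin θ.D | SideTouches (i.Ω n) b.1 b.2},
          wt θ.L i.η n * ‖covDerivFwd i.η U₀ p.2 (H' X) p.1‖ ≤ B₀'H * ‖X‖) ∧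
        (∀ X : XSpace θ.D i.k θ.𝔸, Bd2 θ.L i.η i.k i.Ω (covLap i.η U₀ (H' X)) (B₂' * ‖X‖)) ∧
        (∀ (Y : XSpace θ.D i.k θ.𝔸) (n : ℕ) (hn : n ≤ i.k) (y : Site θ.D), y ∈ i.Λs i.k n →
          QprimeIter (zdBlocking θ.D θ.L) (bgT θ.L U₀) n (H' Y) y = Y (⟨n, Nat.lt_succ_of_le hn⟩, y)) ∧
        (∀ (f : Site θ.D → θ.𝔸) (r : ℝ), 0 ≤ r → Bd2 θ.L i.η i.k i.Ω f r →
          (∀ x, ‖g f x‖ ≤ BG * r) ∧ ∀ n, n ≤ i.k → ∀ p ∈ {b : Site θ.D × Fin θ.D | SideTouches (i.Ω n) b.1 b.2},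
            wt θ.L i.η n * ‖covDerivFwd i.η U₀ p.2 (g f) p.1‖ ≤ BG * r) ∧
        (∀ (f : Site θ.D → θ.𝔸) (r : ℝ), 0 ≤ r → Bd2 θ.L i.η i.k i.Ω f r → Bd2 θ.L i.η i.k i.Ω (f - g (qs (c (q (g f))))) (BR * r)))
    -- the SOURCELESS b9 socket of Proposition 3's frame over PRINT's class, at the law members only ([4] Thm 3.3; threshold `cB9`) — for Prop. 3 AS PRINTED
    (SB9P : ∀ i : ZdIdx θ.D θ.L, i.Ω 0 = Set.univ → IdxB8LawsB θ.L i → B8ConstraintBonds.DomainSeq θ.L i.Ω → (∀ l, l < i.k → ∀ z ∈ i.Λs i.k l, ((θ.L : ℤ) ^ l) • z ∈ B8ConstraintBonds.Lam θ.L i.Ω l) →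
      SockB9P3H2 (𝔸 := θ.𝔸) θ.L lam.inp.B₀ lam.B₀β cB9 lam.β lam.len i.η i.k i.Ω i.Λs (fun m j => towerBondsP θ.L i.Ω (i.Λs m) j))
    -- PROPOSITION 5 at an arbitrary family `lan`, PROPOSITION 6 on the record's cube family at `c₁` — DISPLAYED (Proposition 7 is SERVED below)
    {J : Type} {lan : J → B8.LandauData}
    (p5e : B8.Prop5Exists lam.inp.B₀' lam.B₁ lan) (p5u : B8.Prop5Unique lan)
    (c₁ : ℝ) (p6 : B8.Prop6Printed θ.D (θ.L : ℝ) lam.B₁ c₁ (fun j : IdxB8SubB θ => cubB8OfRecord θ j.1))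
    -- THEOREM 8's CONSTANTS, the layer equations, the sourced free-constant guard, the two SOURCED b9 sockets at the law members
    {c59 cP3 γ₈ γ' γ'' γβ B₈ B₈β : ℝ} (hc59 : 0 < c59) (hcP3 : 0 < cP3) (hγ₈ : 1 ≤ γ₈) (hγ' : 0 ≤ γ') (hγ'' : 0 ≤ γ'')
    (hB : 2 ≤ 5 * (θ.D : ℝ) * θ.L * lam.inp.B₀) (hB₀β : 0 < lam.B₀β) (hB₀8 : lam.inp.B₀ ≤ B₈)
    (hγB : 5 * (θ.D : ℝ) * θ.L * lam.inp.B₀ + 2 * (γ' * lam.inp.B₀) ≤ 5 * (θ.D : ℝ) * θ.L * B₈)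
    (hγB'' : 5 * (θ.D : ℝ) * θ.L * lam.inp.B₀ + 2 * (γ'' * lam.inp.B₀) ≤ 5 * (θ.D : ℝ) * θ.L * B₈)
    (hB8β : 5 * (θ.D : ℝ) * θ.L * lam.B₀β + 2 * lam.B₀β * (γ'' * lam.inp.B₀) + γβ ≤ 5 * (θ.D : ℝ) * θ.L * B₈β)
    (hB₁' : lam.B₁' = 5 * (θ.D : ℝ) * θ.L * B₈)
    (hB₁eq : lam.B₁ = 5 * (θ.D : ℝ) * θ.L * B₈ * (1 + 11 * (θ.D : ℝ) ^ 2)) (hB₂eq : lam.B₂ = 5 * (θ.D : ℝ) * θ.L * B₈β * (1 + 11 * (θ.D : ℝ) ^ 2))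
    (hfreeS : 3 * (2 * (θ.D : ℝ) * (θ.L : ℝ) ^ 2) * BG * BR * (B₈ + γ₈) ≤ lam.inp.B₀' * B₈)
    -- [Balaban1985BackgroundPropagators] Thm 3.3 WITH SOURCE in Theorem 4's frame at (1.146), γ′ letter, threshold `c59`, at the law members ONLY — HYPOTHESIS
    (SH59src : ∀ i : ZdIdx θ.D θ.L, i.Ω 0 = Set.univ → IdxB8LawsB θ.L i → B8ConstraintBonds.DomainSeq θ.L i.Ω → (∀ l, l < i.k → ∀ z ∈ i.Λs i.k l, ((θ.L : ℤ) ^ l) • z ∈ B8ConstraintBonds.Lam θ.L i.Ω l) → ∀ α₀ α₁ : ℝ, 0 < α₀ → 0 < α₁ → α₀ + α₁ ≤ c59 →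
      ∀ U₀ U' : Site θ.D → Fin θ.D → θ.𝔸ˣ, (∀ x κ, U₀ x κ ∈ unitaryUnits θ.𝔸) → (∀ x κ, U' x κ ∈ unitaryUnits θ.𝔸) →
      ∀ φ : Site θ.D → θ.𝔸, ((InR138 θ.L i.k i.η (i.Ω 0) (i.Λs i.k) U₀ φ ∧ (∀ x, IsSelfAdjoint (φ x)) ∧ (∀ x, x ∉ i.Ω 0 → φ x = 0) ∧
          Bdd θ.L i.k i.η (-(2 : ℝ)) (fun j (x : Site θ.D) => x ∈ i.Ω j) φ) ∧
        msup θ.L i.k i.η (-(2 : ℝ)) (fun j (x : Site θ.D) => x ∈ i.Ω j) φ < γ₈ * (α₀ + α₁)) →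
      InAk θ.L i.k i.η α₀ i.Ω U₀ → InAk θ.L i.k i.η α₀ i.Ω (mulCfg U' U₀) → (∀ m, m ≤ i.k → InAx θ.L m (i.Λs m) U₀ (mulCfg U' U₀)) →
      (∀ j, j ≤ i.k → ∀ (z : Site θ.D) (μ : Fin θ.D),
        ((∀ x, InBox (tlo θ.L z j) (thi θ.L z j) x → x ∈ i.Ω j) ∨ (∀ x, InBox (tlo θ.L (z + e μ) j) (thi θ.L (z + e μ) j) x → x ∈ i.Ω j)) →
        ‖(avgIter θ.L (mulCfg U' U₀) j z μ : θ.𝔸) - (avgIter θ.L U₀ j z μ : θ.𝔸)‖ ≤ α₁) →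
      (∀ b ∈ {b : Site θ.D × Fin θ.D | SideTouches (i.Ω 0) b.1 b.2}, ‖((U' b.1 b.2 : θ.𝔸ˣ) : θ.𝔸) - 1‖ ≤ α₁) →
      (∀ m, 1 ≤ m → m ≤ i.k → ∀ (u : Site θ.D → θ.𝔸ˣ) (W : Site θ.D → Fin θ.D → θ.𝔸ˣ) (A' : Site θ.D → Fin θ.D → θ.𝔸),
        (∀ x, u x ∈ unitaryUnits θ.𝔸) → mgauge U₀ u W = U' → Restr129 θ.L m (i.Λs m) U₀ u → LanF146 θ.L i.k i.η (i.Ω 0) i.Λs U₀ φ m W →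
        (∀ y τ, IsSelfAdjoint (A' y τ)) →
        (∀ j, j ≤ m → ∀ y τ, SideTouches (i.Ω j) y τ →
        W y τ = cfgExp i.η A' y τ ∧ ‖A' y τ‖ ≤ (2 * (θ.L * (5 * (θ.D : ℝ) * θ.L * B₈ * (α₀ + α₁))) + 8 * (8 * lam.inp.B₀' * (5 * (θ.D : ℝ) * θ.L * B₈) * (α₀ + α₁))) * ((θ.L : ℝ) ^ j * i.η)⁻¹) →
        (∀ y τ, (∀ j, j ≤ m → ¬ SideTouches (i.Ω j) y τ) → A' y τ = 0) →
        msup θ.L m i.η (-(1 : ℝ)) (fun j (b : Site θ.D × Fin θ.D) => SideTouches (i.Ω j) b.1 b.2) (fun b => A' b.1 b.2)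
        ≤ lam.inp.B₀ * (bondNorm θ.L m i.η (-(3 : ℝ)) i.Ω (fun x μ => Jcur i.η U₀ A' μ x)
        + wsup 1 (fun p : {p : ℕ × (Site θ.D × Fin θ.D) // p.1 ≤ m ∧ p.2 ∈ towerBondsP θ.L i.Ω (i.Λs m) p.1} =>
        linCovIter θ.L U₀ (iEta i.η A') p.1.1 p.1.2.1 p.1.2.2)) + γ' * lam.inp.B₀ * (α₀ + α₁) ∧
        msup θ.L m i.η (-(2 : ℝ)) (fun j (t : Fin θ.D × Fin θ.D × Site θ.D) => SideTouches (i.Ω j) t.2.2 t.2.1)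
        (fun t => covDerivFwd i.η U₀ t.1 (fun z => A' z t.2.1) t.2.2)
        ≤ lam.inp.B₀ * (bondNorm θ.L m i.η (-(3 : ℝ)) i.Ω (fun x μ => Jcur i.η U₀ A' μ x)
        + wsup 1 (fun p : {p : ℕ × (Site θ.D × Fin θ.D) // p.1 ≤ m ∧ p.2 ∈ towerBondsP θ.L i.Ω (i.Λs m) p.1} =>
        linCovIter θ.L U₀ (iEta i.η A') p.1.1 p.1.2.1 p.1.2.2)) + γ' * lam.inp.B₀ * (α₀ + α₁)))
    -- THE SOURCED b9 SOCKET OF PROPOSITION 3's FRAME at the `Ω₀ = ℤᵈ` law members, threshold `cP3`, `|B₁|` over print's class at the top truncation — HYPOTHESIS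
    -- ([Balaban1985BackgroundPropagators] Thm 3.3 with source; = `B8Prop3SrcZd3HPGamma`'s input letter for letter)
    (SB9srcHP : ∀ i : ZdIdx θ.D θ.L, i.Ω 0 = Set.univ → IdxB8LawsB θ.L i → B8ConstraintBonds.DomainSeq θ.L i.Ω → (∀ l, l < i.k → ∀ z ∈ i.Λs i.k l, ((θ.L : ℤ) ^ l) • z ∈ B8ConstraintBonds.Lam θ.L i.Ω l) → ∀ α₀ α₁ α₂ : ℝ, 0 < α₀ → α₀ ≤ cP3 → 0 < α₁ → 0 < α₂ → α₂ ≤ cP3 →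
      ∀ (U₀ W : Site θ.D → Fin θ.D → θ.𝔸ˣ), (∀ x κ, U₀ x κ ∈ unitaryUnits θ.𝔸) → (∀ x κ, W x κ ∈ unitaryUnits θ.𝔸) →
      ∀ f : Site θ.D → θ.𝔸, InR138 θ.L i.k i.η (i.Ω 0) (i.Λs i.k) U₀ f →
      (∀ x, IsSelfAdjoint (f x)) → (∀ x, x ∉ i.Ω 0 → f x = 0) →
      Bdd θ.L i.k i.η (-(2 : ℝ)) (fun j (x : Site θ.D) => x ∈ i.Ω j) f →
      msup θ.L i.k i.η (-(2 : ℝ)) (fun j (x : Site θ.D) => x ∈ i.Ω j) f < γ₈ * (α₀ + α₁) →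
      msup θ.L i.k i.η (-(3 : ℝ)) (fun j (p : Fin θ.D × Site θ.D) => p.2 ∈ i.Ω j) (fun p => covDerivFwd i.η U₀ p.1 f p.2) < γ₈ * (α₀ + α₁) →
      InAk θ.L i.k i.η α₀ i.Ω U₀ → InAk θ.L i.k i.η α₀ i.Ω (mulCfg W U₀) → IsLandau146W θ.L i.k i.η (i.Ω 0) (i.Λs i.k) U₀ f W →
      ∀ A' : Site θ.D → Fin θ.D → θ.𝔸, (∀ y τ, IsSelfAdjoint (A' y τ)) →
      (∀ j, j ≤ i.k → ∀ (y : Site θ.D) (τ : Fin θ.D), SideTouches (i.Ω j) y τ →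
        W y τ = cfgExp i.η A' y τ ∧ ‖A' y τ‖ ≤ α₂ * ((θ.L : ℝ) ^ j * i.η)⁻¹) →
      (∀ (y : Site θ.D) (τ : Fin θ.D), (∀ j, j ≤ i.k → ¬ SideTouches (i.Ω j) y τ) → A' y τ = 0) →
      msup θ.L i.k i.η (-(1 : ℝ)) (fun j (b : Site θ.D × Fin θ.D) => SideTouches (i.Ω j) b.1 b.2) (fun b => A' b.1 b.2)
          ≤ lam.inp.B₀ * (bondNorm θ.L i.k i.η (-(3 : ℝ)) i.Ω (fun x μ => Jcur i.η U₀ A' μ x)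
            + wsup 1 (fun p : {p : ℕ × (Site θ.D × Fin θ.D) // p.1 ≤ i.k ∧ p.2 ∈ towerBondsP θ.L i.Ω (i.Λs i.k) p.1} =>
                linCovIter θ.L U₀ (iEta i.η A') p.1.1 p.1.2.1 p.1.2.2)) + γ'' * lam.inp.B₀ * (α₀ + α₁) ∧
        msup θ.L i.k i.η (-(2 : ℝ)) (fun j (t : Fin θ.D × Fin θ.D × Site θ.D) => SideTouches (i.Ω j) t.2.2 t.2.1)
            (fun t => covDerivFwd i.η U₀ t.1 (fun z => A' z t.2.1) t.2.2)
          ≤ lam.inp.B₀ * (bondNorm θ.L i.k i.η (-(3 : ℝ)) i.Ω (fun x μ => Jcur i.η U₀ A' μ x)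
            + wsup 1 (fun p : {p : ℕ × (Site θ.D × Fin θ.D) // p.1 ≤ i.k ∧ p.2 ∈ towerBondsP θ.L i.Ω (i.Λs i.k) p.1} =>
                linCovIter θ.L U₀ (iEta i.η A') p.1.1 p.1.2.1 p.1.2.2)) + γ'' * lam.inp.B₀ * (α₀ + α₁) ∧
        bondNorm θ.L i.k i.η (-(3 : ℝ)) i.Ω (fun x μ => pdiv i.η U₀ (plaqCovDeriv i.η U₀ A') μ x)
          ≤ lam.inp.B₀ * (bondNorm θ.L i.k i.η (-(3 : ℝ)) i.Ω (fun x μ => Jcur i.η U₀ A' μ x)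
            + wsup 1 (fun p : {p : ℕ × (Site θ.D × Fin θ.D) // p.1 ≤ i.k ∧ p.2 ∈ towerBondsP θ.L i.Ω (i.Λs i.k) p.1} =>
                linCovIter θ.L U₀ (iEta i.η A') p.1.1 p.1.2.1 p.1.2.2)) + γ'' * lam.inp.B₀ * (α₀ + α₁) ∧
        bondNorm θ.L i.k i.η (-(3 : ℝ)) i.Ω (fun x μ => covLap i.η U₀ (fun z => A' z μ) x)
          ≤ lam.inp.B₀ * (bondNorm θ.L i.k i.η (-(3 : ℝ)) i.Ω (fun x μ => Jcur i.η U₀ A' μ x)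
            + wsup 1 (fun p : {p : ℕ × (Site θ.D × Fin θ.D) // p.1 ≤ i.k ∧ p.2 ∈ towerBondsP θ.L i.Ω (i.Λs i.k) p.1} =>
                linCovIter θ.L U₀ (iEta i.η A') p.1.1 p.1.2.1 p.1.2.2)) + γ'' * lam.inp.B₀ * (α₀ + α₁) ∧
        msup θ.L i.k i.η (-(2 + lam.β)) (fun j (q : Fin θ.D × Fin θ.D × (Site θ.D × Site θ.D)) => q.2.2 ∈ AdmPair i.η lam.len ∧ q.2.2.1 ∈ i.Ω j ∧ q.2.2.2 ∈ i.Ω j)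
            (fun q => hquot i.η lam.β lam.len U₀ (covDerivFwd i.η U₀ q.1 (fun z => A' z q.2.1)) q.2.2)
          ≤ lam.B₀β * (bondNorm θ.L i.k i.η (-(3 : ℝ)) i.Ω (fun x μ => Jcur i.η U₀ A' μ x)
            + wsup 1 (fun p : {p : ℕ × (Site θ.D × Fin θ.D) // p.1 ≤ i.k ∧ p.2 ∈ towerBondsP θ.L i.Ω (i.Λs i.k) p.1} =>
                linCovIter θ.L U₀ (iEta i.η A') p.1.1 p.1.2.1 p.1.2.2)) + γβ * (α₀ + α₁)) :
    B8LeafOfRecordSubBP₂D θ (lam.cutSubB J lan c₁) :=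
  (b8LeafOfRecordSubBP₂D_cutSubB_iff lam J lan c₁).2
    (b8LeafRSC_P2D_of_knit_lettersSrc_γ' lam hD hC₂eq hcB9 hB₀'H hB₂' hBG hBR hcL SLet SLetUB SB9P p5e p5u c₁ p6 hc59 hcP3 hγ₈ hγ' hγ'' hB hB₀β hB₀8 hγB hγB'' hB8β hB₁' hB₁eq hB₂eq hfreeS SH59src SB9srcHP)

/-- ★★★ **THE RE-PINNED SLOT AT THE PRINT-CLASS CUT LAYER WITH PROP 5 AT `zdLan` — EVERY PRINTED MEMBER OF [B8] SERVED** (`Iff.rfl`-deep: dag-n05-e's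
`b8LeafOfRecordSubBP₂D_cutSubBP_iff` ∘ D9c₂C at `c₁ := 0` ∘ `B8LeafRSC.withP6`): D9d₂C′'s hypotheses VERBATIM ⊢ `B8LeafOfRecordSubBP₂D θ (λ.cutSubBP J (zdLan θ.L λ.B₁ ∘ ι) c₁⋆ ρ₀)`.  Hypotheses: [4]'s letters
and b9 sockets at the COLLAR law members (`SLet SLetUB SB9P SH59src SB9srcHP` — both-points Hölder lines), [4]'s letters at the `zdLan` members (`SLetL SLetLU`, `hfree2`),
Theorem 8's constants ∕ layer equations ∕ guards, p596570's witness clause `hP6`, the dial `hB₁big` — NO printed member of [B8].  USE at the record: `obtain ⟨ρ₀, B₁⋆, c₁⋆,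
hρ₀, -, hB₁⋆, hc₁⋆, hP6⟩ := prop6Printed_zdCubP_γ_holds_record_dvd θ hD hL5 (t := 1) le_rfl`, then this theorem.
[cite: Balaban1985RegularSpaces, Lemma 1 – Thm 8 pp.79–101, Prop. 6 (1.135)–(1.138) p.99, p.98; Balaban1985BackgroundPropagators, Thm 3.1 p.397, Thm 3.3 p.398] -/
theorem b8LeafOfRecordSubBP₂D_cutSubBP_zdLan_printCube_of_knit_lettersSrc_γ' {θ : Stage3Params} (lam : ResidB8 θ) (hD : 2 ≤ θ.D)
    {cB9 B₀'H B₂' BG BR cL : ℝ}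
    (hC₂eq : lam.C₂ = 2097152 * ((θ.D : ℝ) + 1) ^ 2 * (θ.L : ℝ) ^ 2)
    (hcB9 : 0 < cB9) (hB₀'H : 0 < B₀'H) (hB₂' : 0 ≤ B₂') (hBG : 0 ≤ BG) (hBR : 0 ≤ BR) (hcL : 0 < cL)
    -- [4]'s letters AT THE `Ω₀ = ℤᵈ` LAW MEMBERS ONLY: existence side (laws on print's domains) and uniqueness side
    (SLet : ∀ i : ZdIdx θ.D θ.L, i.Ω 0 = Set.univ → IdxB8LawsB θ.L i → B8ConstraintBonds.DomainSeq θ.L i.Ω → (∀ l, l < i.k → ∀ z ∈ i.Λs i.k l, ((θ.L : ℤ) ^ l) • z ∈ B8ConstraintBonds.Lam θ.L i.Ω l) → SockLettersRD (𝔸 := θ.𝔸) θ.L BG BR B₀'H B₂' cL i.η i.k i.Ω i.Λs)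
    (SLetUB : ∀ i : ZdIdx θ.D θ.L, i.Ω 0 = Set.univ → IdxB8LawsB θ.L i → B8ConstraintBonds.DomainSeq θ.L i.Ω → (∀ l, l < i.k → ∀ z ∈ i.Λs i.k l, ((θ.L : ℤ) ^ l) • z ∈ B8ConstraintBonds.Lam θ.L i.Ω l) → ∀ α₀ : ℝ, 0 < α₀ → α₀ ≤ cL → ∀ U₀ : Site θ.D → Fin θ.D → θ.𝔸ˣ, (∀ x κ, U₀ x κ ∈ unitaryUnits θ.𝔸) →
      InAk θ.L i.k i.η α₀ i.Ω U₀ →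
      ∃ (g Δ : (Site θ.D → θ.𝔸) →ₗ[ℂ] (Site θ.D → θ.𝔸)) (q : (Site θ.D → θ.𝔸) →ₗ[ℂ] (ℕ → Site θ.D → θ.𝔸))
        (qs : (ℕ → Site θ.D → θ.𝔸) →ₗ[ℂ] (Site θ.D → θ.𝔸)) (Aw c : (ℕ → Site θ.D → θ.𝔸) →ₗ[ℂ] (ℕ → Site θ.D → θ.𝔸))
        (H' : XSpace θ.D i.k θ.𝔸 →ₗ[ℂ] (Site θ.D → θ.𝔸)),
        (∀ x : Site θ.D → θ.𝔸, (∃ C : ℝ, ∀ y, ‖x y‖ ≤ C) → g (Δ x + qs (Aw (q x))) = x) ∧ (∀ φ, qs (c (q (g (g (qs φ))))) = qs φ) ∧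
        (∀ (f : Site θ.D → θ.𝔸), ∀ x ∈ i.Ω 0, Δ f x = covLap i.η U₀ ((i.Ω 0).indicator f) x) ∧
        (∀ (μ : ℕ → Site θ.D → θ.𝔸), ∀ x ∈ i.Ω 0, qs μ x = QT θ.L i.k (i.Λs i.k) U₀ μ x) ∧
        (∀ (f : Site θ.D → θ.𝔸) (n : ℕ), n ≤ i.k → ∀ y ∈ i.Λs i.k n, q f n y = QprimeIter (zdBlocking θ.D θ.L) (bgT θ.L U₀) n f y) ∧
        (∀ (f : Site θ.D → θ.𝔸) (n : ℕ) (y : Site θ.D), ¬ (n ≤ i.k ∧ y ∈ i.Λs i.k n) → q f n y = 0) ∧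
        (∀ (X : XSpace θ.D i.k θ.𝔸) (x : Site θ.D), ‖H' X x‖ ≤ B₀'H * ‖X‖) ∧
        (∀ n, n ≤ i.k → ∀ (X : XSpace θ.D i.k θ.𝔸), ∀ p ∈ {b : Site θ.D × Fin θ.D | SideTouches (i.Ω n) b.1 b.2},
          wt θ.L i.η n * ‖covDerivFwd i.η U₀ p.2 (H' X) p.1‖ ≤ B₀'H * ‖X‖) ∧
        (∀ X : XSpace θ.D i.k θ.𝔸, Bd2 θ.L i.η i.k i.Ω (covLap i.η U₀ (H' X)) (B₂' * ‖X‖)) ∧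
        (∀ (Y : XSpace θ.D i.k θ.𝔸) (n : ℕ) (hn : n ≤ i.k) (y : Site θ.D), y ∈ i.Λs i.k n →
          QprimeIter (zdBlocking θ.D θ.L) (bgT θ.L U₀) n (H' Y) y = Y (⟨n, Nat.lt_succ_of_le hn⟩, y)) ∧
        (∀ (f : Site θ.D → θ.𝔸) (r : ℝ), 0 ≤ r → Bd2 θ.L i.η i.k i.Ω f r →
          (∀ x, ‖g f x‖ ≤ BG * r) ∧ ∀ n, n ≤ i.k → ∀ p ∈ {b : Site θ.D × Fin θ.D | SideTouches (i.Ω n) b.1 b.2},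
            wt θ.L i.η n * ‖covDerivFwd i.η U₀ p.2 (g f) p.1‖ ≤ BG * r) ∧
        (∀ (f : Site θ.D → θ.𝔸) (r : ℝ), 0 ≤ r → Bd2 θ.L i.η i.k i.Ω f r → Bd2 θ.L i.η i.k i.Ω (f - g (qs (c (q (g f))))) (BR * r)))
    -- the SOURCELESS b9 socket of Proposition 3's frame over PRINT's class, at the law members only ([4] Thm 3.3; threshold `cB9`) — for Prop. 3 AS PRINTED
    (SB9P : ∀ i : ZdIdx θ.D θ.L, i.Ω 0 = Set.univ → IdxB8LawsB θ.L i → B8ConstraintBonds.DomainSeq θ.L i.Ω → (∀ l, l < i.k → ∀ z ∈ i.Λs i.k l, ((θ.L : ℤ) ^ l) • z ∈ B8ConstraintBonds.Lam θ.L i.Ω l) →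
      SockB9P3H2 (𝔸 := θ.𝔸) θ.L lam.inp.B₀ lam.B₀β cB9 lam.β lam.len i.η i.k i.Ω i.Λs (fun m j => towerBondsP θ.L i.Ω (i.Λs m) j))
    -- PROPOSITION 6 on the record's cube family at `c₁`, PROPOSITION 7 at the P-members — DISPLAYED
    -- the free-constant condition of the Prop.-5 provider (at half `B₀′`)
    (hfree2 : 3 * (2 * (θ.D : ℝ) * (θ.L : ℝ) ^ 2) * BG * BR ≤ lam.inp.B₀' / 2)
    -- PROPOSITION 5's INDEX READ AS OBJECTS: `zdLan` members obeying the member laws, with [4]'s letters at each (RD currency)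
    {J : Type} (ι : J → ZdLanIdx θ.D θ.𝔸)
    (hΩ0L : ∀ a : J, (ι a).Ω 0 = Set.univ) (hΩL : ∀ a : J, ∀ j, (ι a).Ω (j + 1) ⊆ (ι a).Ω j)
    (htowerL : ∀ a : J, ∀ j, j ≤ (ι a).k → ∀ y ∈ (ι a).Λ j, ∀ x, InBox (tlo θ.L y j) (thi θ.L y j) x → x ∈ (ι a).Ω j)
    (SLetL : ∀ a : J, ∀ α₀ : ℝ, 0 < α₀ → α₀ ≤ cL → InAk θ.L (ι a).k (ι a).η α₀ (ι a).Ω (ι a).U₀ →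
      ∃ (g Δ : (Site θ.D → θ.𝔸) →ₗ[ℂ] (Site θ.D → θ.𝔸)) (q : (Site θ.D → θ.𝔸) →ₗ[ℂ] (ℕ → Site θ.D → θ.𝔸))
        (qs : (ℕ → Site θ.D → θ.𝔸) →ₗ[ℂ] (Site θ.D → θ.𝔸)) (Aw c : (ℕ → Site θ.D → θ.𝔸) →ₗ[ℂ] (ℕ → Site θ.D → θ.𝔸))
        (H' : XSpace θ.D (ι a).k θ.𝔸 →ₗ[ℂ] (Site θ.D → θ.𝔸)),
        (∀ x, ∀ y ∈ (ι a).Ω 0, (Δ (g x) + qs (Aw (q (g x)))) y = x y) ∧ (∀ f, q (g (g (qs (c (q f))))) = q f) ∧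
        (∀ (f : Site θ.D → θ.𝔸), ∀ x ∈ (ι a).Ω 0, Δ f x = covLap (ι a).η (ι a).U₀ (((ι a).Ω 0).indicator f) x) ∧
        (∀ (μ : ℕ → Site θ.D → θ.𝔸), ∀ x ∈ (ι a).Ω 0, qs μ x = QT θ.L (ι a).k (ι a).Λ (ι a).U₀ μ x) ∧
        (∀ (f : Site θ.D → θ.𝔸) (j : ℕ), j ≤ (ι a).k → ∀ y ∈ (ι a).Λ j, q f j y = QprimeIter (zdBlocking θ.D θ.L) (bgT θ.L (ι a).U₀) j f y) ∧
        (∀ (X : XSpace θ.D (ι a).k θ.𝔸) (x : Site θ.D), ‖H' X x‖ ≤ B₀'H * ‖X‖) ∧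
        (∀ j, j ≤ (ι a).k → ∀ (X : XSpace θ.D (ι a).k θ.𝔸), ∀ p ∈ {b : Site θ.D × Fin θ.D | SideTouches ((ι a).Ω j) b.1 b.2},
          wt θ.L (ι a).η j * ‖covDerivFwd (ι a).η (ι a).U₀ p.2 (H' X) p.1‖ ≤ B₀'H * ‖X‖) ∧
        (∀ X : XSpace θ.D (ι a).k θ.𝔸, Bd2 θ.L (ι a).η (ι a).k (ι a).Ω (covLap (ι a).η (ι a).U₀ (H' X)) (B₂' * ‖X‖)) ∧
        (∀ (X : XSpace θ.D (ι a).k θ.𝔸) (x : Site θ.D), x ∉ (ι a).Ω 0 → H' X x = 0) ∧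
        (∀ X Y : XSpace θ.D (ι a).k θ.𝔸, (∀ p, Y p = -star (X p)) → ∀ x, H' Y x = -star (H' X x)) ∧
        (∀ (Y : XSpace θ.D (ι a).k θ.𝔸) (j : ℕ) (hj : j ≤ (ι a).k) (y : Site θ.D), y ∈ (ι a).Λ j →
          QprimeIter (zdBlocking θ.D θ.L) (bgT θ.L (ι a).U₀) j (H' Y) y = Y (⟨j, Nat.lt_succ_of_le hj⟩, y)) ∧
        (∀ (f : Site θ.D → θ.𝔸) (r : ℝ), 0 ≤ r → Bd2 θ.L (ι a).η (ι a).k (ι a).Ω f r →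
          (∀ x, ‖g f x‖ ≤ BG * r) ∧ ∀ j, j ≤ (ι a).k → ∀ p ∈ {b : Site θ.D × Fin θ.D | SideTouches ((ι a).Ω j) b.1 b.2},
            wt θ.L (ι a).η j * ‖covDerivFwd (ι a).η (ι a).U₀ p.2 (g f) p.1‖ ≤ BG * r) ∧
        (∀ (f : Site θ.D → θ.𝔸) (x : Site θ.D), x ∉ (ι a).Ω 0 → g f x = 0) ∧
        (∀ f : Site θ.D → θ.𝔸, (∀ j, j ≤ (ι a).k → ∀ x ∈ (ι a).Ω j, IsSelfAdjoint (f x)) → ∀ x, IsSelfAdjoint (g f x)) ∧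
        (∀ (f : Site θ.D → θ.𝔸) (r : ℝ), 0 ≤ r → Bd2 θ.L (ι a).η (ι a).k (ι a).Ω f r →
          Bd2 θ.L (ι a).η (ι a).k (ι a).Ω (f - g (qs (c (q (g f))))) (BR * r)) ∧
        (∀ f : Site θ.D → θ.𝔸, (∀ j, j ≤ (ι a).k → ∀ x ∈ (ι a).Ω j, IsSelfAdjoint (f x)) →
          ∀ j, j ≤ (ι a).k → ∀ x ∈ (ι a).Ω j, IsSelfAdjoint ((f - g (qs (c (q (g f))))) x)))
    -- [4]'s UNIQUENESS letters at the Prop-5 members (left-inverse law of G′ on bounded functions), for Prop. 5's uniqueness clause there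
    (SLetLU : ∀ a : J, ∀ α₀ : ℝ, 0 < α₀ → α₀ ≤ cL → InAk θ.L (ι a).k (ι a).η α₀ (ι a).Ω (ι a).U₀ →
      ∃ (g Δ : (Site θ.D → θ.𝔸) →ₗ[ℂ] (Site θ.D → θ.𝔸)) (q : (Site θ.D → θ.𝔸) →ₗ[ℂ] (ℕ → Site θ.D → θ.𝔸)) (qs : (ℕ → Site θ.D → θ.𝔸) →ₗ[ℂ] (Site θ.D → θ.𝔸))
        (Aw c : (ℕ → Site θ.D → θ.𝔸) →ₗ[ℂ] (ℕ → Site θ.D → θ.𝔸)) (H' : XSpace θ.D (ι a).k θ.𝔸 →ₗ[ℂ] (Site θ.D → θ.𝔸)),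
        (∀ x : Site θ.D → θ.𝔸, (∃ C : ℝ, ∀ y, ‖x y‖ ≤ C) → g (Δ x + qs (Aw (q x))) = x) ∧ (∀ φ, qs (c (q (g (g (qs φ))))) = qs φ) ∧
        (∀ (f : Site θ.D → θ.𝔸), ∀ x ∈ (ι a).Ω 0, Δ f x = covLap (ι a).η (ι a).U₀ (((ι a).Ω 0).indicator f) x) ∧
        (∀ (μ : ℕ → Site θ.D → θ.𝔸), ∀ x ∈ (ι a).Ω 0, qs μ x = QT θ.L (ι a).k (ι a).Λ (ι a).U₀ μ x) ∧
        (∀ (f : Site θ.D → θ.𝔸) (n : ℕ), n ≤ (ι a).k → ∀ y ∈ (ι a).Λ n, q f n y = QprimeIter (zdBlocking θ.D θ.L) (bgT θ.L (ι a).U₀) n f y) ∧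
        (∀ (f : Site θ.D → θ.𝔸) (n : ℕ) (y : Site θ.D), ¬ (n ≤ (ι a).k ∧ y ∈ (ι a).Λ n) → q f n y = 0) ∧
        (∀ (X : XSpace θ.D (ι a).k θ.𝔸) (x : Site θ.D), ‖H' X x‖ ≤ B₀'H * ‖X‖) ∧
        (∀ n, n ≤ (ι a).k → ∀ (X : XSpace θ.D (ι a).k θ.𝔸), ∀ p ∈ {b : Site θ.D × Fin θ.D | SideTouches ((ι a).Ω n) b.1 b.2},
          wt θ.L (ι a).η n * ‖covDerivFwd (ι a).η (ι a).U₀ p.2 (H' X) p.1‖ ≤ B₀'H * ‖X‖) ∧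
        (∀ X : XSpace θ.D (ι a).k θ.𝔸, Bd2 θ.L (ι a).η (ι a).k (ι a).Ω (covLap (ι a).η (ι a).U₀ (H' X)) (B₂' * ‖X‖)) ∧
        (∀ (Y : XSpace θ.D (ι a).k θ.𝔸) (n : ℕ) (hn : n ≤ (ι a).k) (y : Site θ.D), y ∈ (ι a).Λ n →
          QprimeIter (zdBlocking θ.D θ.L) (bgT θ.L (ι a).U₀) n (H' Y) y = Y (⟨n, Nat.lt_succ_of_le hn⟩, y)) ∧
        (∀ (f : Site θ.D → θ.𝔸) (r : ℝ), 0 ≤ r → Bd2 θ.L (ι a).η (ι a).k (ι a).Ω f r →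
          (∀ x, ‖g f x‖ ≤ BG * r) ∧ ∀ n, n ≤ (ι a).k → ∀ p ∈ {b : Site θ.D × Fin θ.D | SideTouches ((ι a).Ω n) b.1 b.2},
            wt θ.L (ι a).η n * ‖covDerivFwd (ι a).η (ι a).U₀ p.2 (g f) p.1‖ ≤ BG * r) ∧
        (∀ (f : Site θ.D → θ.𝔸) (r : ℝ), 0 ≤ r → Bd2 θ.L (ι a).η (ι a).k (ι a).Ω f r →
          Bd2 θ.L (ι a).η (ι a).k (ι a).Ω (f - g (qs (c (q (g f))))) (BR * r)))
    -- PROPOSITION 6's θ-LEVEL WITNESS CLAUSE (= the fourth conjunct of `B8Prop6PrintedZdCubPGamma.prop6Printed_zdCubP_γ_holds_record_dvd`, p596570) + ONE dial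
    {ρ₀ : ℕ} {B₁s c₁s : ℝ}
    (hP6 : ∀ {ι : Type} (f : ι → ZdIdx θ.D θ.L) (B₁'' c₁'' : ℝ), B₁s ≤ B₁'' → c₁'' ≤ c₁s →
      B8.Prop6Printed θ.D (θ.L : ℝ) B₁'' c₁'' (fun j => zdCubP θ.𝔸 θ.L ρ₀ (f j)))
    (hB₁big : B₁s ≤ lam.B₁)
    -- THEOREM 8's CONSTANTS, the layer equations, the sourced free-constant guard, the two SOURCED b9 sockets at the law members
    {c59 cP3 γ₈ γ' γ'' γβ B₈ B₈β : ℝ} (hc59 : 0 < c59) (hcP3 : 0 < cP3) (hγ₈ : 1 ≤ γ₈) (hγ' : 0 ≤ γ') (hγ'' : 0 ≤ γ'')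
    (hB : 2 ≤ 5 * (θ.D : ℝ) * θ.L * lam.inp.B₀) (hB₀β : 0 < lam.B₀β) (hB₀8 : lam.inp.B₀ ≤ B₈)
    (hγB : 5 * (θ.D : ℝ) * θ.L * lam.inp.B₀ + 2 * (γ' * lam.inp.B₀) ≤ 5 * (θ.D : ℝ) * θ.L * B₈)
    (hγB'' : 5 * (θ.D : ℝ) * θ.L * lam.inp.B₀ + 2 * (γ'' * lam.inp.B₀) ≤ 5 * (θ.D : ℝ) * θ.L * B₈)
    (hB8β : 5 * (θ.D : ℝ) * θ.L * lam.B₀β + 2 * lam.B₀β * (γ'' * lam.inp.B₀) + γβ ≤ 5 * (θ.D : ℝ) * θ.L * B₈β)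
    (hB₁' : lam.B₁' = 5 * (θ.D : ℝ) * θ.L * B₈)
    (hB₁eq : lam.B₁ = 5 * (θ.D : ℝ) * θ.L * B₈ * (1 + 11 * (θ.D : ℝ) ^ 2)) (hB₂eq : lam.B₂ = 5 * (θ.D : ℝ) * θ.L * B₈β * (1 + 11 * (θ.D : ℝ) ^ 2))
    (hfreeS : 3 * (2 * (θ.D : ℝ) * (θ.L : ℝ) ^ 2) * BG * BR * (B₈ + γ₈) ≤ lam.inp.B₀' * B₈)
    -- [Balaban1985BackgroundPropagators] Thm 3.3 WITH SOURCE in Theorem 4's frame at (1.146), γ′ letter, threshold `c59`, at the law members ONLY — HYPOTHESIS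
    (SH59src : ∀ i : ZdIdx θ.D θ.L, i.Ω 0 = Set.univ → IdxB8LawsB θ.L i → B8ConstraintBonds.DomainSeq θ.L i.Ω → (∀ l, l < i.k → ∀ z ∈ i.Λs i.k l, ((θ.L : ℤ) ^ l) • z ∈ B8ConstraintBonds.Lam θ.L i.Ω l) → ∀ α₀ α₁ : ℝ, 0 < α₀ → 0 < α₁ → α₀ + α₁ ≤ c59 →
      ∀ U₀ U' : Site θ.D → Fin θ.D → θ.𝔸ˣ, (∀ x κ, U₀ x κ ∈ unitaryUnits θ.𝔸) → (∀ x κ, U' x κ ∈ unitaryUnits θ.𝔸) →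
      ∀ φ : Site θ.D → θ.𝔸, ((InR138 θ.L i.k i.η (i.Ω 0) (i.Λs i.k) U₀ φ ∧ (∀ x, IsSelfAdjoint (φ x)) ∧ (∀ x, x ∉ i.Ω 0 → φ x = 0) ∧
          Bdd θ.L i.k i.η (-(2 : ℝ)) (fun j (x : Site θ.D) => x ∈ i.Ω j) φ) ∧
        msup θ.L i.k i.η (-(2 : ℝ)) (fun j (x : Site θ.D) => x ∈ i.Ω j) φ < γ₈ * (α₀ + α₁)) →
      InAk θ.L i.k i.η α₀ i.Ω U₀ → InAk θ.L i.k i.η α₀ i.Ω (mulCfg U' U₀) → (∀ m, m ≤ i.k → InAx θ.L m (i.Λs m) U₀ (mulCfg U' U₀)) →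
      (∀ j, j ≤ i.k → ∀ (z : Site θ.D) (μ : Fin θ.D),
        ((∀ x, InBox (tlo θ.L z j) (thi θ.L z j) x → x ∈ i.Ω j) ∨ (∀ x, InBox (tlo θ.L (z + e μ) j) (thi θ.L (z + e μ) j) x → x ∈ i.Ω j)) →
        ‖(avgIter θ.L (mulCfg U' U₀) j z μ : θ.𝔸) - (avgIter θ.L U₀ j z μ : θ.𝔸)‖ ≤ α₁) →
      (∀ b ∈ {b : Site θ.D × Fin θ.D | SideTouches (i.Ω 0) b.1 b.2}, ‖((U' b.1 b.2 : θ.𝔸ˣ) : θ.𝔸) - 1‖ ≤ α₁) →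
      (∀ m, 1 ≤ m → m ≤ i.k → ∀ (u : Site θ.D → θ.𝔸ˣ) (W : Site θ.D → Fin θ.D → θ.𝔸ˣ) (A' : Site θ.D → Fin θ.D → θ.𝔸),
        (∀ x, u x ∈ unitaryUnits θ.𝔸) → mgauge U₀ u W = U' → Restr129 θ.L m (i.Λs m) U₀ u → LanF146 θ.L i.k i.η (i.Ω 0) i.Λs U₀ φ m W →
        (∀ y τ, IsSelfAdjoint (A' y τ)) →
        (∀ j, j ≤ m → ∀ y τ, SideTouches (i.Ω j) y τ →
        W y τ = cfgExp i.η A' y τ ∧ ‖A' y τ‖ ≤ (2 * (θ.L * (5 * (θ.D : ℝ) * θ.L * B₈ * (α₀ + α₁))) + 8 * (8 * lam.inp.B₀' * (5 * (θ.D : ℝ) * θ.L * B₈) * (α₀ + α₁))) * ((θ.L : ℝ) ^ j * i.η)⁻¹) →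
        (∀ y τ, (∀ j, j ≤ m → ¬ SideTouches (i.Ω j) y τ) → A' y τ = 0) →
        msup θ.L m i.η (-(1 : ℝ)) (fun j (b : Site θ.D × Fin θ.D) => SideTouches (i.Ω j) b.1 b.2) (fun b => A' b.1 b.2)
        ≤ lam.inp.B₀ * (bondNorm θ.L m i.η (-(3 : ℝ)) i.Ω (fun x μ => Jcur i.η U₀ A' μ x)
        + wsup 1 (fun p : {p : ℕ × (Site θ.D × Fin θ.D) // p.1 ≤ m ∧ p.2 ∈ towerBondsP θ.L i.Ω (i.Λs m) p.1} =>
        linCovIter θ.L U₀ (iEta i.η A') p.1.1 p.1.2.1 p.1.2.2)) + γ' * lam.inp.B₀ * (α₀ + α₁) ∧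
        msup θ.L m i.η (-(2 : ℝ)) (fun j (t : Fin θ.D × Fin θ.D × Site θ.D) => SideTouches (i.Ω j) t.2.2 t.2.1)
        (fun t => covDerivFwd i.η U₀ t.1 (fun z => A' z t.2.1) t.2.2)
        ≤ lam.inp.B₀ * (bondNorm θ.L m i.η (-(3 : ℝ)) i.Ω (fun x μ => Jcur i.η U₀ A' μ x)
        + wsup 1 (fun p : {p : ℕ × (Site θ.D × Fin θ.D) // p.1 ≤ m ∧ p.2 ∈ towerBondsP θ.L i.Ω (i.Λs m) p.1} =>
        linCovIter θ.L U₀ (iEta i.η A') p.1.1 p.1.2.1 p.1.2.2)) + γ' * lam.inp.B₀ * (α₀ + α₁)))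
    -- THE SOURCED b9 SOCKET OF PROPOSITION 3's FRAME at the `Ω₀ = ℤᵈ` law members, threshold `cP3`, `|B₁|` over print's class at the top truncation — HYPOTHESIS
    -- ([Balaban1985BackgroundPropagators] Thm 3.3 with source; = `B8Prop3SrcZd3HPGamma`'s input letter for letter)
    (SB9srcHP : ∀ i : ZdIdx θ.D θ.L, i.Ω 0 = Set.univ → IdxB8LawsB θ.L i → B8ConstraintBonds.DomainSeq θ.L i.Ω → (∀ l, l < i.k → ∀ z ∈ i.Λs i.k l, ((θ.L : ℤ) ^ l) • z ∈ B8ConstraintBonds.Lam θ.L i.Ω l) → ∀ α₀ α₁ α₂ : ℝ, 0 < α₀ → α₀ ≤ cP3 → 0 < α₁ → 0 < α₂ → α₂ ≤ cP3 →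
      ∀ (U₀ W : Site θ.D → Fin θ.D → θ.𝔸ˣ), (∀ x κ, U₀ x κ ∈ unitaryUnits θ.𝔸) → (∀ x κ, W x κ ∈ unitaryUnits θ.𝔸) →
      ∀ f : Site θ.D → θ.𝔸, InR138 θ.L i.k i.η (i.Ω 0) (i.Λs i.k) U₀ f →
      (∀ x, IsSelfAdjoint (f x)) → (∀ x, x ∉ i.Ω 0 → f x = 0) →
      Bdd θ.L i.k i.η (-(2 : ℝ)) (fun j (x : Site θ.D) => x ∈ i.Ω j) f →
      msup θ.L i.k i.η (-(2 : ℝ)) (fun j (x : Site θ.D) => x ∈ i.Ω j) f < γ₈ * (α₀ + α₁) →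
      msup θ.L i.k i.η (-(3 : ℝ)) (fun j (p : Fin θ.D × Site θ.D) => p.2 ∈ i.Ω j) (fun p => covDerivFwd i.η U₀ p.1 f p.2) < γ₈ * (α₀ + α₁) →
      InAk θ.L i.k i.η α₀ i.Ω U₀ → InAk θ.L i.k i.η α₀ i.Ω (mulCfg W U₀) → IsLandau146W θ.L i.k i.η (i.Ω 0) (i.Λs i.k) U₀ f W →
      ∀ A' : Site θ.D → Fin θ.D → θ.𝔸, (∀ y τ, IsSelfAdjoint (A' y τ)) →
      (∀ j, j ≤ i.k → ∀ (y : Site θ.D) (τ : Fin θ.D), SideTouches (i.Ω j) y τ →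
        W y τ = cfgExp i.η A' y τ ∧ ‖A' y τ‖ ≤ α₂ * ((θ.L : ℝ) ^ j * i.η)⁻¹) →
      (∀ (y : Site θ.D) (τ : Fin θ.D), (∀ j, j ≤ i.k → ¬ SideTouches (i.Ω j) y τ) → A' y τ = 0) →
      msup θ.L i.k i.η (-(1 : ℝ)) (fun j (b : Site θ.D × Fin θ.D) => SideTouches (i.Ω j) b.1 b.2) (fun b => A' b.1 b.2)
          ≤ lam.inp.B₀ * (bondNorm θ.L i.k i.η (-(3 : ℝ)) i.Ω (fun x μ => Jcur i.η U₀ A' μ x)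
            + wsup 1 (fun p : {p : ℕ × (Site θ.D × Fin θ.D) // p.1 ≤ i.k ∧ p.2 ∈ towerBondsP θ.L i.Ω (i.Λs i.k) p.1} =>
                linCovIter θ.L U₀ (iEta i.η A') p.1.1 p.1.2.1 p.1.2.2)) + γ'' * lam.inp.B₀ * (α₀ + α₁) ∧
        msup θ.L i.k i.η (-(2 : ℝ)) (fun j (t : Fin θ.D × Fin θ.D × Site θ.D) => SideTouches (i.Ω j) t.2.2 t.2.1)
            (fun t => covDerivFwd i.η U₀ t.1 (fun z => A' z t.2.1) t.2.2)
          ≤ lam.inp.B₀ * (bondNorm θ.L i.k i.η (-(3 : ℝ)) i.Ω (fun x μ => Jcur i.η U₀ A' μ x)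
            + wsup 1 (fun p : {p : ℕ × (Site θ.D × Fin θ.D) // p.1 ≤ i.k ∧ p.2 ∈ towerBondsP θ.L i.Ω (i.Λs i.k) p.1} =>
                linCovIter θ.L U₀ (iEta i.η A') p.1.1 p.1.2.1 p.1.2.2)) + γ'' * lam.inp.B₀ * (α₀ + α₁) ∧
        bondNorm θ.L i.k i.η (-(3 : ℝ)) i.Ω (fun x μ => pdiv i.η U₀ (plaqCovDeriv i.η U₀ A') μ x)
          ≤ lam.inp.B₀ * (bondNorm θ.L i.k i.η (-(3 : ℝ)) i.Ω (fun x μ => Jcur i.η U₀ A' μ x)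
            + wsup 1 (fun p : {p : ℕ × (Site θ.D × Fin θ.D) // p.1 ≤ i.k ∧ p.2 ∈ towerBondsP θ.L i.Ω (i.Λs i.k) p.1} =>
                linCovIter θ.L U₀ (iEta i.η A') p.1.1 p.1.2.1 p.1.2.2)) + γ'' * lam.inp.B₀ * (α₀ + α₁) ∧
        bondNorm θ.L i.k i.η (-(3 : ℝ)) i.Ω (fun x μ => covLap i.η U₀ (fun z => A' z μ) x)
          ≤ lam.inp.B₀ * (bondNorm θ.L i.k i.η (-(3 : ℝ)) i.Ω (fun x μ => Jcur i.η U₀ A' μ x)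
            + wsup 1 (fun p : {p : ℕ × (Site θ.D × Fin θ.D) // p.1 ≤ i.k ∧ p.2 ∈ towerBondsP θ.L i.Ω (i.Λs i.k) p.1} =>
                linCovIter θ.L U₀ (iEta i.η A') p.1.1 p.1.2.1 p.1.2.2)) + γ'' * lam.inp.B₀ * (α₀ + α₁) ∧
        msup θ.L i.k i.η (-(2 + lam.β)) (fun j (q : Fin θ.D × Fin θ.D × (Site θ.D × Site θ.D)) => q.2.2 ∈ AdmPair i.η lam.len ∧ q.2.2.1 ∈ i.Ω j ∧ q.2.2.2 ∈ i.Ω j)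
            (fun q => hquot i.η lam.β lam.len U₀ (covDerivFwd i.η U₀ q.1 (fun z => A' z q.2.1)) q.2.2)
          ≤ lam.B₀β * (bondNorm θ.L i.k i.η (-(3 : ℝ)) i.Ω (fun x μ => Jcur i.η U₀ A' μ x)
            + wsup 1 (fun p : {p : ℕ × (Site θ.D × Fin θ.D) // p.1 ≤ i.k ∧ p.2 ∈ towerBondsP θ.L i.Ω (i.Λs i.k) p.1} =>
                linCovIter θ.L U₀ (iEta i.η A') p.1.1 p.1.2.1 p.1.2.2)) + γβ * (α₀ + α₁)) :
    B8LeafOfRecordSubBP₂D θ (lam.cutSubBP J (fun a : J => zdLan θ.L lam.B₁ (ι a)) c₁s ρ₀) :=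
  (b8LeafOfRecordSubBP₂D_cutSubBP_iff lam J (fun a : J => zdLan θ.L lam.B₁ (ι a)) c₁s ρ₀).2
    ((b8LeafRSC_P2D_zdLan_of_knit_lettersSrc_γ' lam hD hC₂eq hcB9 hB₀'H hB₂' hBG hBR hcL SLet SLetUB SB9P hfree2 ι hΩ0L hΩL htowerL SLetL SLetLU 0 
      (prop6Printed_cubB8OfRecord_subB_of_nonpos (le_trans one_le_two hD) le_rfl) hc59 hcP3 hγ₈ hγ' hγ'' hB hB₀β hB₀8 hγB hγB'' hB8β hB₁' hB₁eq hB₂eq hfreeS SH59src SB9srcHP).withP6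
      (hP6 (fun j : IdxB8SubB θ => j.1.1) lam.B₁ c₁s hB₁big le_rfl))

end Slot

end Summit.QuantumFields.YangMills.BalabanUVNodes.N05SubBP2DSlotGammaPrime

end
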